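import Summits.BirchSwinnertonDyer.BirchSwinnertonDyer.Theorems.ClassRecordThreeEulerHalvesAtThreeKolyvaginFamilyLevelSupplyClosing
import Summits.BirchSwinnertonDyer.BirchSwinnertonDyer.Theorems.ClassRecordThreeEulerHalvesAtThreeLevelSupplyB6DOfPoitouTate
import Summits.BirchSwinnertonDyer.BirchSwinnertonDyer.Theorems.ClassRecordThreeCornerAtThreeShimuraSwapSupplyOfPoitouTateGenericTD
import Summits.BirchSwinnertonDyer.BirchSwinnertonDyer.Theorems.ClassRecordThreeCornerAtThreeShimuraSwapFamilyCebotarev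
import Summits.BirchSwinnertonDyer.BirchSwinnertonDyer.Theorems.ClassRecordThreeCornerAtThreeShimuraFamilyProducersLocal
import Summits.BirchSwinnertonDyer.BirchSwinnertonDyer.Theorems.ClassRecordThreeEulerHalvesAtThreeShimuraFamilyProducersLocalTamagawa
import Summits.BirchSwinnertonDyer.BirchSwinnertonDyer.Theorems.ClassRecordThreeCornerAtThreeShimuraFamilyProducers
import Summits.BirchSwinnertonDyer.BirchSwinnertonDyer.Theorems.ClassRecordThreeCornerAtThreeShimuraFamilyH47Orders
import Summits.BirchSwinnertonDyer.BirchSwinnertonDyer.Theorems.ClassRecordThreeCornerAtThreeShimuraFamilyTransverse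
import Summits.BirchSwinnertonDyer.BirchSwinnertonDyer.Theorems.ClassRecordThreeCornerAtThreeShimuraWalkB6DDefs
import Summits.BirchSwinnertonDyer.BirchSwinnertonDyer.Theorems.Rank1ResidualJetRingClassFields
import HarnessLib

/-!
# THE TWO PORT TARGETS OF THE SHIMURA-CURVE JETCHEV WALK AND ITS (DIV) CLAUSE AT ANY ODD PRIME `p ∈ S`, IMAGE-KEYED, with the identity-component
# label (B6) asked ONLY AT THE CARRIER PRIMES outside `S` (TD frame; the Milne I.3.8 input is a KERNEL THEOREM)
# (cell `bsd-stepL`, seat `bsd-stepL-corner3-p2` g10 = WIDTH-LEVER lane B; `--supports stmt-BirchSwinnertonDyer-21420 --as helper`; serves crux 19065's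
# `stub_shimuraLabelsB6_57` re-cut to (B6)-at-`{q₁}` (corner-p1 g16, STATUS 08:49Z) at `p ∈ {5, 7}` and 19109 ∕ 21420 at `p = 3`)

WHAT. Lane B g9's `…ShimuraPortTargetsOfImage` (p611034) VERBATIM with the all-bad-primes label hypothesis REPLACED by the per-carrier singleton
labels `hB6T : ∀ q [Fact q.Prime], q ∣ N → q ∉ S → p ∣ c_q(E/ℚ_q) → LabelB6 ι W N {q} ys` (tam3-p1 g15's B6TD binder shape, p-generic):
* `Koly.shimuraLevelSupplyAt_of_poitouTate_ofImage_of_carrierLabels` — PORT TARGET 2 at every `q ∉ S`; the Kummer producer `hSel` is tam3-p1 g15's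
  `kolyvaginClass_familyData_mem_selmerLocalKer_of_labelsAt_of_tamagawa` (receptacle at the carrier places only, Milne *ADT* I Prop. 3.8 at the
  Tamagawa-free places) with its Milne hypothesis DISCHARGED by lane B g10's kernel theorem
  `MilneTamagawa.Milne2006_localTamagawaNumber_smul_unramifiedClass_eq_zero_holds` (p619455); the stringent producer `hstrq` at the exempted carrier `q`
  (`t = ord_p c_q ≥ 1`, so `p ∣ c_q` and `hB6T q` applies) is tam3-p1 g15's `localization_kolyvaginClass_familyData_mem_stringentFamily_of_labelB6_singleton`;
* `Koly.shimuraSwapSupplyAt_of_poitouTate_ofImage_of_carrierLabels` — PORT TARGET 1: lane B g10's `swapSupplyAt_of_poitouTate_of_hceb_of_carrierLabels` ∘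
  corner-p1's `hceb_family_ofImage`;
* `Koly.shimuraDivClause_of_poitouTate_ofImage_of_carrierLabels` — the (DIV) CLAUSE at `p` from the two targets (`JET.Section6.depth_le_mdiv_of_swap_of_perLevel`).
Every other step is p611034's text (tam3-p1's level END, lane B g8's ∀-datum producers `hsign` ∕ `h47`, corner-p1's image-keyed Čebotarev).

HONEST FRAMING: conditional theorems (inputs `hPT`, the labels incl. (B6) at the carriers, the image inputs); no definition, no named fact, no `sorry`;
nothing booked; no stub ∕ item closes here; no census label moves (T7); BSD is not proved by any of this. Credit: as p611034 + tam3-p1 g15 (TD producers).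
References (locators only): [cite: Jetchev2008, Thm. 1.1, Thm. 1.4, Thm. 6.3, Prop. 6.4, Prop. 4.9, Lemma 5.1] [cite: McCallumLMS1991, §5 Prop. 5.2, Cor. 5.6,
§4 Prop. 4.4, §3 Cor. 3.2] [cite: GrossLMS1991, §3 (3.2), Prop. 5.4, §6 Prop. 6.2 (1)] [cite: MilneADT2006, Ch. I Prop. 3.8, Thm. 4.10(b)]
[cite: CasselsFrohlichANT1967, Ch. VII Prop. 1.2 (ii)]. presearch: not applicable (re-keying of tree theorems). Axioms: `propext`, `Classical.choice`, `Quot.sound`.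
-/

set_option autoImplicit false
set_option linter.dupNamespace false

noncomputable section

open scoped Classical NumberField Pointwise

namespace Summit.BirchSwinnertonDyer.Rank1Residual.X11b.Three.Koly

open WeierstrassCurve IsDedekindDomain NumberField Field Function Literature.NumberTheory.EllipticCurves
  Literature.NumberTheory.EllipticCurves.ModularForms Literature.NumberTheory.EllipticCurves.Jetchev2008
  Literature.NumberTheory.EllipticCurves.KolyvaginCocycle
  Literature.NumberTheory.EllipticCurves.Rank1Residual Literature.NumberTheory.GaloisRepresentations
  Literature.NumberTheory.GaloisCohomology Literature.NumberTheory.Automorphic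
  Literature.NumberTheory.EllipticCurves.KolyvaginEuler
  Summit.BirchSwinnertonDyer.Rank1Residual.JET Summit.BirchSwinnertonDyer.Rank1Residual.JET.SelmerVocabulary
  Summit.BirchSwinnertonDyer.Rank1Residual.JET.Walk Summit.BirchSwinnertonDyer.Rank1Residual.JET.GlobalDuality
  Summit.BirchSwinnertonDyer.BirchSwinnertonDyer.Theorems
  Literature.NumberTheory.EllipticCurves.ShimuraCMFamily
open Summit.BirchSwinnertonDyer.BirchSwinnertonDyer.Theorems.ShimuraWalk (frobLevelIndex natCast_le_frobLevelIndex_iff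
  LevelSupplyAt LabelsAt)

set_option maxHeartbeats 800000 in
/-- **PORT TARGET 2 at any odd `p ∈ S`, image-keyed** — `ShimuraWalk.LevelSupplyAt hK ι W N p ys (ord_p c_q)` at every `q ∉ S` from `hPT`, the labels and the
four mod-`p` image inputs over `K`: tam3-p1's level END (p605065 + p606391) with `3 ↦ p`, the image inputs displayed, lane B g8's ∀-datum producers plugged in.
CONDITIONAL; nothing booked. [cite: Jetchev2008, Thm. 1.4, Thm. 6.3, Prop. 6.4, Prop. 4.9] [cite: GrossLMS1991, Prop. 5.4, §6 Prop. 6.2 (1)]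
[cite: McCallumLMS1991, §3 Cor. 3.2, §4 Prop. 4.4] [cite: CasselsFrohlichANT1967, Ch. VII Prop. 1.2 (ii)] -/
theorem shimuraLevelSupplyAt_of_poitouTate_ofImage_of_carrierLabels
    (hPT : ∀ (K : Type) [Field K] [NumberField K], poitouTate_selmerStructure_duality_conj K)
    (W : WeierstrassCurve ℚ) [W.IsElliptic] [W.IsGloballyMinimal] (N : ℕ) [NeZero N]
    (K : Type) [Field K] [NumberField K] (S : Finset ℕ) (Dt : ModularParametrizationData W N)
    (hN : W.conductorNorm ℤ = N) {p : ℕ} [Fact p.Prime] (hp2 : p ≠ 2) (hirr : W.HasIrreducibleModPGaloisRep p)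
    (hK : IsImaginaryQuadratic K) (hD : NumberField.discr K < -4)
    (hin : ∀ ℓ ∈ S, ℓ.Prime ∧ ℓ ∣ N ∧ ¬ ℓ ^ 2 ∣ N ∧
      ((Ideal.span {(ℓ : ℤ)}).primesOver (𝓞 K)).ncard = 1 ∧ ¬ (ℓ : ℤ) ∣ NumberField.discr K)
    (hsp : ∀ ℓ : ℕ, ℓ.Prime → ℓ ∣ N → ℓ ∉ S → ((Ideal.span {(ℓ : ℤ)}).primesOver (𝓞 K)).ncard = 2)
    (hpS : p ∈ S) (ι : K →+* ℂ) (y : (W.baseChange K).toAffine.Point)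
    (ys : (m : ℕ) → (W.baseChange (ringClassField K ι m)).toAffine.Point) (ε : ℤ)
    (hL : LabelsAt W N K ι y ys ε)
    (hB6T : ∀ (q' : ℕ) [Fact q'.Prime], q' ∣ N → q' ∉ S → p ∣ (W.baseChange ℚ_[q']).localTamagawaNumber ℤ_[q'] →
      LabelB6 ι W N {q'} ys)
    -- the four mod-`p` IMAGE INPUTS over `K` (corner-p1's `_ofImage` binders)
    (hIz : ∃ z : Field.absoluteGaloisGroup K, ∀ t : geomTorsion (W.baseChange K) p, z • t = -t)
    (hIs : (W.baseChange K).HasIrreducibleModPGaloisRep p)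
    (hIc : ∀ f : geomTorsion (W.baseChange K) p →+ geomTorsion (W.baseChange K) p,
      (∀ (g : Field.absoluteGaloisGroup K) (t : geomTorsion (W.baseChange K) p), f (g • t) = g • f t) →
        ∃ k : ℤ, ∀ t, f t = k • t)
    (hIt : AddSubgroup.torsionBy (W.baseChange K).toAffine.Point (p : ℤ) = ⊥)
    (q : ℕ) [Fact q.Prime] (hqS : q ∉ S) :
    LevelSupplyAt hK ι W N p ys (padicValNat p ((W.baseChange ℚ_[q]).localTamagawaNumber ℤ_[q])) := by
  subst hN
  haveI hRCF : ∀ j : ℕ, NumberField (ringClassField K ι j) := numberField_ringClassField K hK ι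
  have hp : p.Prime := Fact.out
  -- the trivial case `t = 0`
  rcases Nat.eq_zero_or_pos (padicValNat p ((W.baseChange ℚ_[q]).localTamagawaNumber ℤ_[q])) with ht0 | htpos
  · rw [ht0]
    intro k c _ _ _
    simp
  set t : ℕ := padicValNat p ((W.baseChange ℚ_[q]).localTamagawaNumber ℤ_[q]) with ht
  -- `p ∣ c_q`, so `q` is a bad prime: `q ∣ N`, and (as `q ∉ S`) it splits in `K`
  obtain ⟨vq, hqq⟩ : ∃ v : HeightOneSpectrum (𝓞 ℚ), (Rat.HeightOneSpectrum.primesEquiv v : ℕ) = q :=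
    ⟨Rat.HeightOneSpectrum.primesEquiv.symm ⟨q, Fact.out⟩, by rw [Equiv.apply_symm_apply]⟩
  have hcq : (W.baseChange ℚ_[q]).localTamagawaNumber ℤ_[q] = W.tamagawaNumberAt vq :=
    WeierstrassCurve.localTamagawaNumber_padic_eq_holds W vq q hqq
  have hbad : ¬ W.HasGoodReductionAt vq := fun hgood ↦ by
    have h1 : W.tamagawaNumberAt vq = 1 :=
      WeierstrassCurve.localTamagawaNumber_eq_one_of_hasGoodReductionAt_holds W vq hgood
    have : t = 0 := by rw [ht, hcq, h1, padicValNat_one_right]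
    omega
  have hqN : q ∣ W.conductorNorm ℤ := by rw [← hqq]; exact (W.dvd_conductorNorm_iff vq).mpr hbad
  have hq2 := hsp q Fact.out hqN hqS
  -- complex conjugation and the carrier place `v₀ ∋ q` moved by it
  have hc1 : (W.baseChange ℚ_[q]).localTamagawaNumber ℤ_[q] ≠ 1 := fun h1 ↦ by
    have : t = 0 := by rw [ht, h1, padicValNat_one_right]
    omega
  haveI : Algebra.IsQuadraticExtension ℚ K := ⟨hK.1⟩
  have hcardG : Nat.card (K ≃ₐ[ℚ] K) = 2 := by rw [IsGalois.card_aut_eq_finrank, hK.1]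
  obtain ⟨τ, hτ, huniq⟩ := (Nat.card_eq_two_iff' (1 : K ≃ₐ[ℚ] K)).mp hcardG
  have hτ2 : τ * τ = 1 := by
    rw [mul_eq_one_iff_eq_inv]
    exact (huniq τ⁻¹ (inv_ne_one.mpr hτ)).symm
  obtain ⟨v₀, hv₀, hv₀N, hqv₀⟩ := ShimuraWalk.exists_split_place_of_ncard_eq_two K hK τ hτ q hq2 hqN
  -- every place `v ∋ q` of `K` is moved by `τ` and is BAD for `E/K` (`c_v = c_q ≠ 1`; CF VII 1.2 (ii))
  have hbadK : ∀ v : HeightOneSpectrum (𝓞 K), ((q : ℕ) : 𝓞 K) ∈ v.asIdeal →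
      ¬ (W.baseChange K).HasGoodReductionAt v := by
    intro v hqv hgood
    obtain ⟨σ, hσ⟩ := HeightOneSpectrum.exists_algEquiv_smul_eq (F := ℚ) (w := v₀) (w' := v)
      (LocalField.heightOneSpectrum_rat_eq_of_natCast_mem q _ _
        (LocalField.natCast_mem_under q v₀ hqv₀) (LocalField.natCast_mem_under q v hqv))
    have hτv : τ • v ≠ v := by
      by_cases hσ1 : σ = 1
      · subst hσ1
        rw [one_smul] at hσ
        subst hσ
        exact hv₀
      · have hστ : σ = τ := huniq σ hσ1
        subst hστ
        subst hσ
        rw [smul_smul, hτ2, one_smul]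
        exact fun h ↦ hv₀ h.symm
    obtain ⟨-, -, hcEq', -, -⟩ := carrierRowData_of_split W K q hK τ v hτv hqv
    exact hc1 (hcEq'.symm.trans
      ((W.baseChange K).localTamagawaNumber_eq_one_of_hasGoodReductionAt_holds v hgood))
  have hqv₀' : ((q : ℕ) : 𝓞 K) ∈ (τ • v₀).asIdeal := by
    have := (HeightOneSpectrum.smul_mem_smul_asIdeal_iff τ v₀ ((q : ℕ) : 𝓞 K)).mpr hqv₀
    rwa [GlobalDuality.smul_natCast_ringOfIntegers] at this
  have hv₀N' : ((W.conductorNorm ℤ : ℕ) : 𝓞 K) ∈ (τ • v₀).asIdeal := by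
    have := (HeightOneSpectrum.smul_mem_smul_asIdeal_iff τ v₀ ((W.conductorNorm ℤ : ℕ) : 𝓞 K)).mpr hv₀N
    rwa [GlobalDuality.smul_natCast_ringOfIntegers] at this
  -- the (δ) row data at `v₀` (Kodaira–Néron cyclicity transported from `ℚ_q`)
  obtain ⟨hminK, hminP, hcEq, hc0, hcyc⟩ := carrierRowData_of_split W K q hK τ v₀ hv₀ hqv₀
  haveI := hminK
  haveI := hminP
  have hpc : p ∣ (W.baseChange ℚ_[q]).localTamagawaNumber ℤ_[q] := dvd_of_one_le_padicValNat htpos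
  haveI := hcyc (kodairaNeron_isAddCyclic_forall W q p hp2 hpc)
  have hfac : (((W.baseChange K).baseChange (v₀.adicCompletion K)).localTamagawaNumber
      (v₀.adicCompletionIntegers K)).factorization p = t := by
    rw [hcEq, ht, Nat.factorization_def _ hp]
  -- the mod-`p` image inputs are HYPOTHESES here (`hIz`, `hIs`, `hIc`, `hIt`)
  -- `p` is unramified in `K` (`p ∈ S`), the Weil pairing
  have hKunr := ShimuraKolyvaginOfImage.isUnramifiedIn_rat_of_not_dvd_discr K hp (hin p hpS).2.2.2.2
  have hW3 := WeierstrassCurve.exists_weilPairing_holds W p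
  -- admissibility for every datum of the family (`E[p]` irreducible; the levels are prime to `p`)
  have hA : ∀ (n : ℕ) (d : KolyvaginFamilyData W K ι n), d.y = ys n → Squarefree n →
      (∀ q' ∈ n.primeFactors, IsKolyvaginPrime (W.conductorNorm ℤ) W K p q') →
      ∀ j : ℕ, IsAdmissible (absoluteGaloisGroup K) d.pointsSubgroup ((p ^ j : ℕ) : ℤ) :=
    fun n d _ hn hKP j ↦ d.isAdmissible_pointsSubgroup_family_of_hasIrreducibleModPGaloisRep hK hn.ne_zero hp hp2
      hirr hW3 hKunr (fun hpn ↦ (hKP p (Nat.mem_primeFactors.mpr ⟨hp, hpn, hn.ne_zero⟩)).2.2.2.1 rfl) j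
  -- invariance of `[P_n]` mod `p^j`, `j ≤ M(n)`, for every datum (tam3-p1's p604825, from (B4) of `LabelsAt`)
  have hP := familyInvariance_of_labelsAt W hK ι hp Dt ys hL
  -- producers: `hsign` p605208, `h47` p605268 (lane B g8); `hSel` ∕ `hstrq` = tam3-p1 g15's TD producers, the Milne input DISCHARGED (lane B g10)
  have hsign : ∀ (c : K ≃ₐ[ℚ] K), c ≠ 1 → ∀ (n : ℕ) (d : KolyvaginFamilyData W K ι n), d.y = ys n → Squarefree n →
      (∀ q' ∈ n.primeFactors, IsKolyvaginPrime (W.conductorNorm ℤ) W K p q') →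
      ∀ j : ℕ, 1 ≤ j → (j : ℕ∞) ≤ frobLevelIndex W K p n →
      ∃ B ∈ d.pointsSubgroup, (isLiftOfAut_liftAut c).pointsMap W (d.toGeomPoints d.derivedPoint) =
        (ε * (-1) ^ n.primeFactors.card) • d.toGeomPoints d.derivedPoint + ((p ^ j : ℕ) : ℤ) • B :=
    fun c hc n d hdy hn hKol j hj hjM ↦
      ShimuraWalk.pointsMap_derivedPoint_familyData_of_labelsAt hK ι Dt hp ys hL hA hc (isLiftOfAut_liftAut c) n d hdy hn
        hKol j hj hjM
  have hSel : ∀ (M n : ℕ) (d : KolyvaginFamilyData W K ι n), 1 ≤ M → d.y = ys n → Squarefree n →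
      (∀ q' ∈ n.primeFactors, IsKolyvaginPrime (W.conductorNorm ℤ) W K p q' ∧ FrobEqFrobInfty W K (p ^ M) q') →
      ∀ 𝔳 : HeightOneSpectrum (𝓞 K), (n : 𝓞 K) ∉ 𝔳.asIdeal →
        d.kolyvaginClass (Fact.out : p.Prime) M ∈
          selmerLocalKer (W.baseChange K) (𝔳.adicCompletion K) ((p ^ M : ℕ) : ℤ) :=
    fun M n d hM hdy hn hKol 𝔳 h𝔳 ↦
      ShimuraWalk.kolyvaginClass_familyData_mem_selmerLocalKer_of_labelsAt_of_tamagawa hK ι rfl Dt hirr hin hsp ys hL hB6T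
        (fun v _ h𝔐 f hf ↦
          MilneTamagawa.Milne2006_localTamagawaNumber_smul_unramifiedClass_eq_zero_holds (W.baseChange K) v h𝔐 f hf)
        hA M n d hM hdy hn hKol 𝔳 h𝔳
  have hstrq : ∀ (k : ℕ) (hn : ((p ^ k : ℕ) : ℤ) ≠ 0) (n : ℕ) (d : KolyvaginFamilyData W K ι n), 1 ≤ k → d.y = ys n →
      Squarefree n →
      (∀ q' ∈ n.primeFactors, IsKolyvaginPrime (W.conductorNorm ℤ) W K p q' ∧ FrobEqFrobInfty W K (p ^ k) q') →
      n.primeFactors.Nonempty →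
      ∀ v : HeightOneSpectrum (𝓞 K), ((q : ℕ) : 𝓞 K) ∈ v.asIdeal →
        galoisCohomology.localization ((W.baseChange K).torsionGaloisModule ((p ^ k : ℕ) : ℤ)) (Sum.inr v) 1
          (d.kolyvaginClass (Fact.out : p.Prime) k) ∈ stringentFamily W K hn (Sum.inr v) :=
    fun k hn' n d hk hdy hn hKol _ v hqv ↦
      ShimuraWalk.localization_kolyvaginClass_familyData_mem_stringentFamily_of_labelB6_singleton hK ι Dt hirr hsp ys hL q
        hqN hqS (hB6T q hqN hqS hpc) hA k hn' n d hk hdy hn hKol v hqv (hbadK v hqv)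
  have h47 : ∀ (k n n' : ℕ) (d : KolyvaginFamilyData W K ι n) (d' : KolyvaginFamilyData W K ι n') (ℓ : ℕ),
      1 ≤ k → d.y = ys n → d'.y = ys n' → Squarefree n →
      (∀ q' ∈ n'.primeFactors, IsKolyvaginPrime (W.conductorNorm ℤ) W K p q' ∧ FrobEqFrobInfty W K (p ^ k) q') →
      ℓ.Prime → ¬ ℓ ∣ n → n' = n * ℓ →
      ∀ v : HeightOneSpectrum (𝓞 K), (ℓ : 𝓞 K) ∈ v.asIdeal →
      addOrderOf (galoisCohomology.localization ((W.baseChange K).torsionGaloisModule ((p ^ k : ℕ) : ℤ))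
          (Sum.inr v) 1 (d'.kolyvaginClass (Fact.out : p.Prime) k)) =
        addOrderOf (galoisCohomology.localization ((W.baseChange K).torsionGaloisModule ((p ^ k : ℕ) : ℤ))
          (Sum.inr v) 1 (d.kolyvaginClass (Fact.out : p.Prime) k)) :=
    fun k n n' d d' ℓ hk hdy hd'y hn hKol hℓ hℓn hn' v hv ↦
      ShimuraWalk.addOrderOf_localization_kolyvaginClass_familyData_eq_of_labels_of_admissible hK hD ι rfl hp2 Dt ys hL hA
        k n n' d d' ℓ hk hdy hd'y hn hKol hℓ hℓn hn' v hv
  -- the END GLUE over the (P2) assembly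
  refine ShimuraWalk.levelSupplyAt_of_familyLevelSupplyGross hK ι Dt hp ys t ?_ ?_
  · -- `hB4` read off (B4) of `LabelsAt`
    intro k hk hKP ℓ hℓ σ hσ
    have hle : ringClassField K ι (k / ℓ) ≤ ringClassField K ι k :=
      ringClassField_mono hK ι (Nat.div_dvd_of_dvd (Nat.dvd_of_mem_primeFactors hℓ)) hk.ne_zero
    exact ⟨_, hL.2.2.2.2.1 k hk (fun q' hq' ↦ ⟨(hKP q' hq').2.1, (hKP q' hq').2.2.2.2.1⟩) ℓ hℓ hle σ hσ⟩
  · refine familyLevelSupply_of_memberships W K hK hD ι p hp2 τ hτ hPT ys ε hL.1 t v₀ hv₀ hv₀N hv₀N'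
      ?_ ?_ hA hP ?_ (hsign τ hτ) ?_ ?_ ?_ h47
    · -- the carrier's (δ) data at every level `p^k ≥ p^t`
      intro _ k hn htk
      refine ⟨fun w ↦ stringentFamily_le_kummer W K hn w,
        fun v' w h _ x hx ↦ conjActPlace_mem_stringentFamily W τ hn h hx,
        isAddCyclic_kummer_quotient_stringentFamily W K hn v₀, ?_⟩
      rw [← hfac]
      exact relIndex_stringentFamily_eq_pow W K hp k hn v₀ hc0 (by rw [hfac]; exact htk)
    · -- Čebotarev at level `p^k` from the mod-`p` image inputs (corner-p1's `_ofImage`)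
      intro k hk j e he x y' hx hy hy0 b
      obtain ⟨ℓ, hbℓ, ⟨hKol, hfrob⟩, hord⟩ :=
        exists_grossKolyvaginPrime_addOrderOf_localization_eq_shift_ofImage W (N := W.conductorNorm ℤ) hK hp2
          hIz hIs hIc hIt τ hτ hk j he x y' hx hy hy0 b
      exact ⟨ℓ, hbℓ, hKol, hfrob, hord⟩
    · -- `τ̃`-stability of `E(K[n]) ⊆ E(K̄)`
      intro n d _ hn
      exact d.pointsMap_mem_pointsSubgroup_family hK hn.ne_zero (isLiftOfAut_liftAut τ)
    · -- Kummer membership of the root classes off `n`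
      exact familyRootKummer_of_selmerLocalKer W hK ι p ys hA hP hSel
    · -- transverse condition of the root classes at the primes of `n`
      intro k n d _ _ hn hG u Q hAk hQ hQP huk ℓ hℓ
      exact ShimuraWalk.rootClass_familyData_mem_transverseKer W hK hD hp2 ι k hn (fun q' hq' ↦ (hG q' hq').1) d u Q
        hAk hQ hQP huk hℓ
    · -- stringent membership at the two carrier places (both lie over `q`)
      intro k hn' n d hk hy hsq hG hne q₀ hq₀
      refine hstrq k hn' n d hk hy hsq hG hne q₀ ?_
      simp only [Finset.mem_insert, Finset.mem_singleton] at hq₀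
      rcases hq₀ with rfl | rfl
      exacts [hqv₀, hqv₀']

/-- **PORT TARGET 1 at any odd `p ∈ S`, image-keyed** — `ShimuraWalk.SwapSupplyAt hK ι W N p ys` from `hPT`, the labels and the four mod-`p` image inputs:
lane B g9's `ShimuraWalk.swapSupplyAt_of_poitouTate_of_hceb` (p609804) with corner-p1's `hceb_family_ofImage`. CONDITIONAL; nothing booked.
[cite: McCallumLMS1991, §5 Prop. 5.2, §3 Cor. 3.2] [cite: Jetchev2008, Lemma 5.1] -/
theorem shimuraSwapSupplyAt_of_poitouTate_ofImage_of_carrierLabels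
    (hPT : ∀ (K : Type) [Field K] [NumberField K], poitouTate_selmerStructure_duality_conj K)
    (W : WeierstrassCurve ℚ) [W.IsElliptic] [W.IsGloballyMinimal] (N : ℕ) [NeZero N]
    (K : Type) [Field K] [NumberField K] (S : Finset ℕ) (Dt : ModularParametrizationData W N)
    (hN : W.conductorNorm ℤ = N) {p : ℕ} [Fact p.Prime] (hp2 : p ≠ 2) (hirr : W.HasIrreducibleModPGaloisRep p)
    (hK : IsImaginaryQuadratic K) (hD : NumberField.discr K < -4)
    (hin : ∀ ℓ ∈ S, ℓ.Prime ∧ ℓ ∣ N ∧ ¬ ℓ ^ 2 ∣ N ∧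
      ((Ideal.span {(ℓ : ℤ)}).primesOver (𝓞 K)).ncard = 1 ∧ ¬ (ℓ : ℤ) ∣ NumberField.discr K)
    (hsp : ∀ ℓ : ℕ, ℓ.Prime → ℓ ∣ N → ℓ ∉ S → ((Ideal.span {(ℓ : ℤ)}).primesOver (𝓞 K)).ncard = 2)
    (hpS : p ∈ S) (ι : K →+* ℂ) (y : (W.baseChange K).toAffine.Point)
    (ys : (m : ℕ) → (W.baseChange (ringClassField K ι m)).toAffine.Point) (ε : ℤ)
    (hL : LabelsAt W N K ι y ys ε)
    (hB6T : ∀ (q' : ℕ) [Fact q'.Prime], q' ∣ N → q' ∉ S → p ∣ (W.baseChange ℚ_[q']).localTamagawaNumber ℤ_[q'] →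
      LabelB6 ι W N {q'} ys)
    -- the four mod-`p` IMAGE INPUTS over `K` (corner-p1's `_ofImage` binders)
    (hIz : ∃ z : Field.absoluteGaloisGroup K, ∀ t : geomTorsion (W.baseChange K) p, z • t = -t)
    (hIs : (W.baseChange K).HasIrreducibleModPGaloisRep p)
    (hIc : ∀ f : geomTorsion (W.baseChange K) p →+ geomTorsion (W.baseChange K) p,
      (∀ (g : Field.absoluteGaloisGroup K) (t : geomTorsion (W.baseChange K) p), f (g • t) = g • f t) →
        ∃ k : ℤ, ∀ t, f t = k • t)
    (hIt : AddSubgroup.torsionBy (W.baseChange K).toAffine.Point (p : ℤ) = ⊥)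
    : ShimuraWalk.SwapSupplyAt hK ι W N p ys := by
  subst hN
  exact ShimuraWalk.swapSupplyAt_of_poitouTate_of_hceb_of_carrierLabels hPT W (W.conductorNorm ℤ) K S Dt rfl hp2 hirr hK hD hin hsp hpS
    ι y ys ε hL hB6T (hceb_family_ofImage W hK hp2 hIz hIs hIc hIt)

set_option maxHeartbeats 400000 in
/-- **The (DIV) CLAUSE at any odd `p ∈ S`, image-keyed** — Jetchev's global divisibility of the derived points in McCallum's presentation-free currency
(`∀ q ∉ S, s ≤ ord_p c_q ⟹ p^{M−s}·P_{k'} ∈ p^M·E(K[k'])` for square-free `k'` on Gross–Kolyvagin primes with `Frob = Frob_∞` on `K(E[p^{M+k}])`; the last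
conjunct of `ShimuraWalk.primitivesDivAtThreeInertD` with `3 ↦ p` = the `hDivLab` binder of the `p`-generic ORDER machine END), from the two port targets by
the (DIV) glue (`JET.Section6.depth_le_mdiv_of_swap_of_perLevel`; `…ShimuraWalkB6DDefs` l.287 with `3 ↦ p`). CONDITIONAL; nothing booked.
[cite: Jetchev2008, Thm. 1.1, Thm. 1.4 (p. 812)] [cite: McCallumLMS1991, §5 Prop. 5.2, Cor. 5.6] -/
theorem shimuraDivClause_of_poitouTate_ofImage_of_carrierLabels
    (hPT : ∀ (K : Type) [Field K] [NumberField K], poitouTate_selmerStructure_duality_conj K)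
    (W : WeierstrassCurve ℚ) [W.IsElliptic] [W.IsGloballyMinimal] (N : ℕ) [NeZero N]
    (K : Type) [Field K] [NumberField K] (S : Finset ℕ) (Dt : ModularParametrizationData W N)
    (hN : W.conductorNorm ℤ = N) {p : ℕ} [Fact p.Prime] (hp2 : p ≠ 2) (hirr : W.HasIrreducibleModPGaloisRep p)
    (hK : IsImaginaryQuadratic K) (hD : NumberField.discr K < -4)
    (hin : ∀ ℓ ∈ S, ℓ.Prime ∧ ℓ ∣ N ∧ ¬ ℓ ^ 2 ∣ N ∧
      ((Ideal.span {(ℓ : ℤ)}).primesOver (𝓞 K)).ncard = 1 ∧ ¬ (ℓ : ℤ) ∣ NumberField.discr K)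
    (hsp : ∀ ℓ : ℕ, ℓ.Prime → ℓ ∣ N → ℓ ∉ S → ((Ideal.span {(ℓ : ℤ)}).primesOver (𝓞 K)).ncard = 2)
    (hpS : p ∈ S) (ι : K →+* ℂ) (y : (W.baseChange K).toAffine.Point)
    (ys : (m : ℕ) → (W.baseChange (ringClassField K ι m)).toAffine.Point) (ε : ℤ)
    (hL : LabelsAt W N K ι y ys ε)
    (hB6T : ∀ (q' : ℕ) [Fact q'.Prime], q' ∣ N → q' ∉ S → p ∣ (W.baseChange ℚ_[q']).localTamagawaNumber ℤ_[q'] →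
      LabelB6 ι W N {q'} ys)
    -- the four mod-`p` IMAGE INPUTS over `K` (corner-p1's `_ofImage` binders)
    (hIz : ∃ z : Field.absoluteGaloisGroup K, ∀ t : geomTorsion (W.baseChange K) p, z • t = -t)
    (hIs : (W.baseChange K).HasIrreducibleModPGaloisRep p)
    (hIc : ∀ f : geomTorsion (W.baseChange K) p →+ geomTorsion (W.baseChange K) p,
      (∀ (g : Field.absoluteGaloisGroup K) (t : geomTorsion (W.baseChange K) p), f (g • t) = g • f t) →
        ∃ k : ℤ, ∀ t, f t = k • t)
    (hIt : AddSubgroup.torsionBy (W.baseChange K).toAffine.Point (p : ℤ) = ⊥)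
    :
    ∀ (q : ℕ) [Fact q.Prime] (s : ℕ), q ∉ S →
          s ≤ padicValNat p ((W.baseChange ℚ_[q]).localTamagawaNumber ℤ_[q]) →
        ∀ (k M k' : ℕ), Squarefree k' →
          (∀ q' ∈ k'.primeFactors, Literature.NumberTheory.EllipticCurves.IsKolyvaginPrime N W K p q' ∧
            Literature.NumberTheory.EllipticCurves.FrobEqFrobInfty W K (p ^ (M + k)) q') →
          letI : CommGroup (Literature.NumberTheory.EllipticCurves.ringClassGal ι k') :=
            { (inferInstance : Group (Literature.NumberTheory.EllipticCurves.ringClassGal ι k')) with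
              mul_comm := fun a b ↦
                (KolyvaginH44.isMulCommutative_ringClassGal' hK ι k').is_comm.comm
                  a b }
          letI : DistribMulAction (Literature.NumberTheory.EllipticCurves.ringClassGal ι k')
              ((W.baseChange (Literature.NumberTheory.EllipticCurves.ringClassField K ι k')).toAffine.Point) :=
            DistribMulAction.compHom _
              ((Literature.NumberTheory.EllipticCurves.pointGalHom W
                (Literature.NumberTheory.EllipticCurves.ringClassField K ι k')).comp
                (Literature.NumberTheory.EllipticCurves.ringClassGal ι k').subtype)
          ∀ (σ' : ℕ → Literature.NumberTheory.EllipticCurves.ringClassGal ι k')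
            (H' : Subgroup (Literature.NumberTheory.EllipticCurves.ringClassGal ι k'))
            [Fintype (Literature.NumberTheory.EllipticCurves.ringClassGal ι k' ⧸ H')]
            (f' : Literature.NumberTheory.EllipticCurves.ringClassGal ι k' ⧸ H' →
              Literature.NumberTheory.EllipticCurves.ringClassGal ι k'),
            (∀ q' ∈ k'.primeFactors, σ' q' ^ (q' + 1) = 1) →
            (∀ q' ∈ k'.primeFactors,
              Subgroup.zpowers (σ' q' : Literature.NumberTheory.EllipticCurves.ringClassField K ι k' ≃ₐ[ℚ]
                Literature.NumberTheory.EllipticCurves.ringClassField K ι k') =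
                Literature.NumberTheory.EllipticCurves.ringClassGalOver ι k' (k' / q')) →
            (∀ c, (f' c : Literature.NumberTheory.EllipticCurves.ringClassGal ι k' ⧸ H') = c) →
            (∀ h ∈ H', (h : Literature.NumberTheory.EllipticCurves.ringClassField K ι k' ≃ₐ[ℚ]
              Literature.NumberTheory.EllipticCurves.ringClassField K ι k') ∈
                Literature.NumberTheory.EllipticCurves.ringClassGalOver ι k' 1) →
            ∃ B : (W.baseChange (Literature.NumberTheory.EllipticCurves.ringClassField K ι k')).toAffine.Point,
              ((p ^ M : ℕ) : ℤ) • B =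
                ((p : ℤ) ^ (M - s)) • kolyvaginPoint σ'
                  k'.primeFactors f' (ys k')
 := by
  intro q _ s hqS hs k M k' hk' hKol σ' H' instF f' h1 h2 h3 h4
  have hswap : ShimuraWalk.SwapSupplyAt hK ι W N p ys :=
    shimuraSwapSupplyAt_of_poitouTate_ofImage_of_carrierLabels hPT W N K S Dt hN hp2 hirr hK hD hin hsp hpS ι y ys ε hL hB6T hIz hIs hIc hIt
  have hlev := shimuraLevelSupplyAt_of_poitouTate_ofImage_of_carrierLabels hPT W N K S Dt hN hp2 hirr hK hD hin hsp hpS ι y ys ε hL hB6T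
    hIz hIs hIc hIt q hqS
  set t : ℕ := padicValNat p ((W.baseChange ℚ_[q]).localTamagawaNumber ℤ_[q]) with ht
  have hKol' : ∀ q' ∈ k'.primeFactors, IsKolyvaginPrime N W K p q' := fun q' hq' ↦ (hKol q' hq').1
  let c : ShimuraWalk.Conductor W K N p := ⟨k', hk', hKol'⟩
  have key : ∀ s' : ℕ, s' ≤ t → s' ≤ M + k → ShimuraWalk.PDiv hK ι W ys p k' s' := by
    intro s' hs't hs'Mk
    have hidx : (s' : ℕ∞) ≤ frobLevelIndex W K p k' :=
      (natCast_le_frobLevelIndex_iff hKol' s').mpr fun q' hq' ↦ (hKol q' hq').2.of_dvd (pow_dvd_pow p hs'Mk)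
    have h := JET.Section6.depth_le_mdiv_of_swap_of_perLevel (Λ := ShimuraWalk.Conductor W K N p)
      (fun c ↦ frobLevelIndex W K p c.1) (fun c ↦ ShimuraWalk.mdiv hK ι W ys p c.1) t hswap hlev s' hs't c hidx
    exact (ShimuraWalk.natCast_le_mdiv_iff hK ι W ys p k' s').mp h
  by_cases hsM : s ≤ M
  · obtain ⟨B₀, hB₀⟩ := key s hs (hsM.trans (Nat.le_add_right M k)) σ' H' f' h1 h2 h3 h4
    refine ⟨B₀, Eq.trans ?_ (congrArg (fun x ↦ ((p : ℤ) ^ (M - s)) • x) hB₀)⟩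
    show ((p ^ M : ℕ) : ℤ) • B₀ = ((p : ℤ) ^ (M - s)) • (((p ^ s : ℕ) : ℤ) • B₀)
    rw [smul_smul]
    congr 1
    push_cast
    rw [← pow_add, Nat.sub_add_cancel hsM]
  · push Not at hsM
    obtain ⟨B₀, hB₀⟩ := key M (hsM.le.trans hs) (Nat.le_add_right M k) σ' H' f' h1 h2 h3 h4
    refine ⟨B₀, hB₀.trans ?_⟩
    rw [Nat.sub_eq_zero_of_le hsM.le, pow_zero, one_smul]

end Summit.BirchSwinnertonDyer.Rank1Residual.X11b.Three.Koly

end
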